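import Summits.QuantumFields.YangMills.Theorems.BalabanUVNodesPortS1FEInduction

/-!
# BalabanUVNodes — port (S1): THE DOMAIN-WIDE («Uc») EDITION OF THE FE INDUCTIVE STEP — (f′) on the whole charted small-field domain `{B : every cut pair lies in U^c_{k+1}(X, α₀, α₁)}`
  ([I] (1.7) on (1.1)–(1.2) p.260, «U_k(ε₀) … contained in all the spaces U^c_j(X, α₀, α₁)» p.263) instead of the germ at `B = 0`; the inductive-step letter `FEStepUc`, its strong induction, and
  the germ edition ✓`PortRecordFEHalfBox` AS A COROLLARY given the small regularity letter `CutsInUcNear` (continuity of the chart at `B = 0`)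
  (porter hand `hand-27930-FE-1` g0, cell `ym-nodeO-ideate`; ★★★ director-ym №613 (1) «the ball edition is the NEXT letter»; ◇ lens-1 g14 `LENS-1-NODE-v20` §2 (L0) ∕ R1 Z1a–Z1b; ◆ CRIT-1 l.5933 (R-b′))

`--supports stmt-QuantumFields-27930` (helper; NO `--workitem`); count-neutral.  [I] = [Balaban1987RG1]; [II] = [Balaban1988RG2Cluster].

WHY.  ✓`…PortS1FEInduction.FEStepBox` states print's inductive step in the tree's currency, whose (f′)-W row ✓`IntFormula.RepresentsW` is a GERM at `B = 0` — and displays the LOCATED CAVEAT that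
print's step consumes (1.7) on the whole small-field domain: the curly bracket of (2.12) evaluates `𝐄_k = Σ_{j<k}(… + 𝓝_{j+1})` ((0.23); ✓`…PortS1FECurlyLevels.recordEkBracket_eq_sum_levels`) at
`U_k(e^{iB′}V^{(k)})` for `B′` filling the (2.9) window — a set of fixed radius that a germ hypothesis does not reach (◇ lens-1 (L0): «the germ letter (f′) is a COROLLARY, never the induction
hypothesis»).  THIS FILE types the domain-wide edition in the record's own coordinates (no pin needed): the representation is asked at EVERY charted datum `B` whose cut pairs lie in the
analyticity domains `recordUc … α₀ α₁ … X` of the SAME radii as the receipts (a)(b) — print's «U_k(ε₀) ⊂ U^c_j(X, α₀, α₁)» reading of where (1.7) holds — and proves the bookkeeping: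
* §1 `CutsInUc … n B` (every cut pair of the charted configuration `(U_{k+1}(W_B), J)` lies in its domain); ★ `IntFormula.RepresentsOnUcW` ((f′)-Uc: the pair identity AT EVERY SUCH `B`);
  ★ `IntLocalFormula.ResidueOnUcAtW` = the six functional-free rows of ✓`ResidueAtW` VERBATIM ∧ (f′)-Uc; `residueAtW_of_onUc` — Uc ⟹ germ GIVEN `∀ᶠ B in 𝓝 0, CutsInUc … B` (the located
  regularity input: continuity of `B ↦ U_{k+1}(W_B)` at `0` (⁸'s `hP9`) + openness of `recordUc` + the unit pair inside — lens-1 R1∕Z1b; NOT proved here, NAMED as `CutsInUcNear`).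
* §2 per-level formats `LZResidueUcAt`, `FEResidueUcBoxAt`; ★★ `FEStepUc F` — ✓`FEStepBox` VERBATIM with `ResidueAtW ↦ ResidueOnUcAtW` on BOTH sides (LZ hypothesis, inductive hypothesis, conclusion):
  THE LETTER PRINT PROVES ([I] Thm 3 at scale `k+1` from (1.7)+(1.18)+(1.19) at scales `≤ k`, domain-wide); `PortRecordLZHalfUc F` — the LZ half, Uc edition (✓`PortRecordLZHalf` with the same
  substitution; OPEN as a letter — the landed LZ files prove the germ edition; their domain-wide strengthening is located, not done); `CutsInUcNear F` — the regularity letter.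
* §3 ★★★ `feResidueUcBoxAt_all_of_step` (strong induction on the scale), `feResidueBoxAt_of_uc` (Uc ⟹ germ per level under `CutsInUcNear`'s body), ★★★ `portRecordFEHalfBox_of_uc :
  (∀ F, PortRecordLZHalfUc F) → (∀ F, FEStepUc F) → (∀ F, CutsInUcNear F) → ∀ F, PortRecordFEHalfBox F` (= the registered stub's type; germ edition as COROLLARY, as lens-1 (L0) prescribes).
(Q-ord) unchanged from ✓`FEStepBox` (and hence from ⁸): `Mth` outermost, antecedent verbatim, `ε₂₉` first, LZ package, then k-UNIFORM `γ₀ E₂ κ α₀ α₁` before `∀ k`; the domain of (f′)-Uc is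
indexed by the SAME `α₀ α₁` (no new constant).  RELATION TO THE GERM LETTER: `FEStepUc` and `FEStepBox` are not comparable by implication (hypotheses and conclusions both strengthen); both
reduce `stub_FE` to print's step; the plan owner chooses which to register (★★★ №613: germ edition v3.6 now, this edition next).
DEDUP: `CutsInUc`, `IntFormula.RepresentsOnUcW`, `IntLocalFormula.ResidueOnUcAtW`, `representsW_of_onUc`, `residueAtW_of_onUc`, `LZResidueUcAt`, `FEResidueUcBoxAt`, `FEStepUc`, `PortRecordLZHalfUc`,
`CutsInUcNear`, `feResidueUcBoxAt_all_of_step`, `feResidueBoxAt_of_uc`, `lzResidueAt_of_uc`, `portRecordFEHalfBox_of_uc` — 0 tree hits (`rg -ow`).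

HONEST STATUS.  Names for a stronger currency, THREE candidate letters (`FEStepUc` XXL, `PortRecordLZHalfUc` L given the landed LZ files, `CutsInUcNear` S–M) — all OPEN, inhabited nowhere —
and kernel bookkeeping; NOTHING of Bałaban's (2.10)–(2.14), §3–§5 or [II] is asserted, ported, discharged or refuted; `stub_FE` NOT closed; ⟨27930⟩ OPEN (1∕3); NODE O 0∕1; COUNT 8∕28 ·
K 1∕4 UNMOVED; finite 𝕋⁴_{L^K} at fixed ε — NOT continuum ∕ OS ∕ Clay; **the Yang–Mills mass gap (Clay) is NOT proved by any of this.**  No `sorry`, `instance`, `notation`; standard axioms.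

References: T. Bałaban, *Renormalization group approach to lattice gauge field theories. I*, Comm. Math. Phys. 109 (1987) 249–301 [Balaban1987RG1] — (1.1)–(1.2) p.260, (1.7) p.261,
(1.11)–(1.16) pp.262–263, p.263 L3–6, (1.18)–(1.19) p.263, Thm 3 p.264, (2.12)–(2.13) p.268, p.268 L27–31; T. Bałaban, *… II*, Comm. Math. Phys. 116 (1988) 1–22 [Balaban1988RG2Cluster] — (1.34) p.9, p.22 L1–5.
-/

noncomputable section

open scoped BigOperators Matrix.Norms.L2Operator Topology

namespace Summit.QuantumFields.YangMills.Theorems.K0RecordFormatNames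

open Literature.MathematicalPhysics.QuantumFieldTheory.Balaban1983to89
open Literature.MathematicalPhysics.QuantumFieldTheory.Balaban1983to89.Node00
open Literature.MathematicalPhysics.QuantumFieldTheory.Balaban1983to89.T4Continuum (T4Family)
open _root_.Filter

variable (F : T4Family)

/-! ## §1  The domain condition, (f′) domain-wide, the Uc residue, and Uc ⟹ germ -/

/-- **`CutsInUc F Mc k α₀ α₁ a₀ ε₂₉ n B` — THE CHARTED DATUM `B` LIES IN THE SMALL-FIELD DOMAIN, READ DOMAIN BY DOMAIN**: every (1.9) pair of `U_{k+1}(W_B)` cut to `X` has its coordinates in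
`U^c_{k+1}(X, α₀, α₁)` of record — print's «U_k(ε₀) … contained in all the spaces U^c_j(X, α₀, α₁)» as a condition on `B`. [cite: Balaban1987RG1, p.263 L3–6, (1.11)–(1.16) pp.262–263] -/
def CutsInUc (Mc k : ℕ) (α₀ α₁ a₀ ε₂₉ : ℝ) (n : ℕ) (B : recordW F a₀ ε₂₉ k (recordK₀ F Mc k + n)) : Prop :=
  ∀ X : (recordDomSys F Mc k (recordK₀ F Mc k + n)).Dom,
    encodeCfg F (recordK₀ F Mc k + n) (pairCutTorusAt F a₀ ε₂₉ Mc k (recordK₀ F Mc k + n) X B) ∈ recordUc F Mc k α₀ α₁ (recordK₀ F Mc k + n) X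

open scoped Classical in
/-- ★ **(f′)-Uc — THE WRAP-AWARE PAIR IDENTITY ON THE WHOLE CHARTED DOMAIN** (✓`IntFormula.RepresentsW` with «eventually at `B = 0`» replaced by «at every `B` with `CutsInUc … B`»): print's (1.7)
where print states it. [cite: Balaban1987RG1, (1.7) p.261, (1.1)–(1.2) p.260, p.263 L3–6] -/
def IntFormula.RepresentsOnUcW (Ψ : IntFormula) (a₀ ε₂₉ : ℝ) (Mc k : ℕ) (α₀ α₁ : ℝ) (Ew : TorusPieces F Mc k)
    (Φf : (n : ℕ) → recordW F a₀ ε₂₉ k (recordK₀ F Mc k + n) → ℂ) : Prop :=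
  ∀ n (B : recordW F a₀ ε₂₉ k (recordK₀ F Mc k + n)), CutsInUc F Mc k α₀ α₁ a₀ ε₂₉ n B →
    Φf n B = ∑ X : (recordDomSys F Mc k (recordK₀ F Mc k + n)).Dom,
      (if X ∈ recordWrapCtr F Mc k (recordK₀ F Mc k + n) then
        Ew n X (pairCutTorusAt F a₀ ε₂₉ Mc k (recordK₀ F Mc k + n) X B)
      else Ψ (intCubes F Mc k (recordK₀ F Mc k + n) X) (pairCutAt F a₀ ε₂₉ Mc k (recordK₀ F Mc k + n) X B))

/-- ★ **THE WRAP-AWARE RESIDUE, DOMAIN-WIDE EDITION**: the six functional-free rows of ✓`IntLocalFormula.ResidueAtW` VERBATIM ((a)(b) off the wrap class, (a)(b)(c)(d) on it) ∧ (f′)-Uc at the SAME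
radii. [cite: Balaban1987RG1, (1.7) p.261, (1.18)–(1.19) p.263, (1.11)–(1.16) pp.262–263] -/
def IntLocalFormula.ResidueOnUcAtW (Mc k : ℕ) (Ψ : IntLocalFormula (F.L ^ (k + 1) * Mc)) (Ew : TorusPieces F Mc k) (a₀ ε₂₉ α₀ α₁ E₀ κ : ℝ)
    (Φf : (n : ℕ) → recordW F a₀ ε₂₉ k (recordK₀ F Mc k + n) → ℂ) : Prop :=
  Ψ.Ψ.AnalyticOnUcOff F Mc k α₀ α₁ ∧ Ψ.Ψ.Bound118OnUcOff F Mc k α₀ α₁ E₀ κ ∧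
    Ew.AnalyticOnW F α₀ α₁ ∧ Ew.Bound118OnW F α₀ α₁ E₀ κ ∧ Ew.LocalOnW F ∧ Ew.GaugeInvOnW F ∧
    Ψ.Ψ.RepresentsOnUcW F a₀ ε₂₉ Mc k α₀ α₁ Ew Φf

variable {F} in
/-- **(f′)-Uc ⟹ (f′)-W (germ)** whenever the charted data near `B = 0` lie in the domains. [cite: Balaban1987RG1, (1.7) p.261 (bookkeeping)] -/
theorem representsW_of_onUc {Ψ : IntFormula} {a₀ ε₂₉ : ℝ} {Mc k : ℕ} {α₀ α₁ : ℝ} {Ew : TorusPieces F Mc k}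
    {Φf : (n : ℕ) → recordW F a₀ ε₂₉ k (recordK₀ F Mc k + n) → ℂ}
    (h : Ψ.RepresentsOnUcW F a₀ ε₂₉ Mc k α₀ α₁ Ew Φf)
    (hnear : ∀ n, letI θ := thetaFill F a₀ ε₂₉; letI := θ.instVβ₁; letI := θ.instVβ₂; letI := θ.instιβ
      ∀ᶠ B in 𝓝 (0 : recordW F a₀ ε₂₉ k (recordK₀ F Mc k + n)), CutsInUc F Mc k α₀ α₁ a₀ ε₂₉ n B) :
    Ψ.RepresentsW F a₀ ε₂₉ Mc k Ew Φf := by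
  intro n
  filter_upwards [hnear n] with B hB
  exact h n B hB

variable {F} in
/-- **Uc residue ⟹ germ residue** under the same near-`0` domain condition. [cite: Balaban1987RG1, (1.7) p.261, (1.18) p.263 (bookkeeping)] -/
theorem residueAtW_of_onUc {Mc k : ℕ} {Ψ : IntLocalFormula (F.L ^ (k + 1) * Mc)} {Ew : TorusPieces F Mc k} {a₀ ε₂₉ α₀ α₁ E₀ κ : ℝ}
    {Φf : (n : ℕ) → recordW F a₀ ε₂₉ k (recordK₀ F Mc k + n) → ℂ}
    (h : Ψ.ResidueOnUcAtW F Mc k Ew a₀ ε₂₉ α₀ α₁ E₀ κ Φf)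
    (hnear : ∀ n, letI θ := thetaFill F a₀ ε₂₉; letI := θ.instVβ₁; letI := θ.instVβ₂; letI := θ.instιβ
      ∀ᶠ B in 𝓝 (0 : recordW F a₀ ε₂₉ k (recordK₀ F Mc k + n)), CutsInUc F Mc k α₀ α₁ a₀ ε₂₉ n B) :
    Ψ.ResidueAtW F Mc k Ew a₀ ε₂₉ α₀ α₁ E₀ κ Φf :=
  ⟨h.1, h.2.1, h.2.2.1, h.2.2.2.1, h.2.2.2.2.1, h.2.2.2.2.2.1, representsW_of_onUc h.2.2.2.2.2.2 hnear⟩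

end Summit.QuantumFields.YangMills.Theorems.K0RecordFormatNames

namespace Summit.QuantumFields.YangMills.Theorems.BalabanUVNodesPortS1

open Summit.QuantumFields.YangMills.Theorems.K0RecordFormatNames
open Literature.MathematicalPhysics.QuantumFieldTheory.Balaban1983to89
open Literature.MathematicalPhysics.QuantumFieldTheory.Balaban1983to89.Node00
open Literature.MathematicalPhysics.QuantumFieldTheory.Balaban1983to89.T4Continuum (T4Family)
open _root_.Filter

/-! ## §2  Per-level Uc formats; the Uc step letter; the LZ half, Uc edition; the regularity letter -/

/-- **The LZ half's residue at ONE level, Uc edition.** [cite: Balaban1987RG1, (1.4) p.260, (1.7) p.261, (1.18) p.263] -/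
def LZResidueUcAt (F : T4Family) (Mc : ℕ) (a₀ ε₂₉ α₀ α₁ E₁ κ : ℝ) (k : ℕ) : Prop :=
  ∃ (Ψ : IntLocalFormula (F.L ^ (k + 1) * Mc)) (Ew : TorusPieces F Mc k), Ψ.ResidueOnUcAtW F Mc k Ew a₀ ε₂₉ α₀ α₁ E₁ κ (phiLZ F Mc a₀ ε₂₉ k)

/-- **The FE half's residue at ONE level on the box, Uc edition.** [cite: Balaban1987RG1, (2.12)–(2.13) p.268, (1.7) p.261, (1.18) p.263] -/
def FEResidueUcBoxAt (F : T4Family) (Mc : ℕ) (a₀ ε₂₉ γ₀ α₀ α₁ E₂ κ : ℝ) (k : ℕ) : Prop :=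
  ∀ v : Fin (k + 1) → ℝ, v ∈ FlowStep.Box γ₀ k →
    ∃ (Ψ : IntLocalFormula (F.L ^ (k + 1) * Mc)) (Ew : TorusPieces F Mc k), Ψ.ResidueOnUcAtW F Mc k Ew a₀ ε₂₉ α₀ α₁ E₂ κ (phiFE F Mc a₀ ε₂₉ k v)

/-- ★★ **`FEStepUc F` — PRINT's INDUCTIVE STEP, DOMAIN-WIDE EDITION** (✓`FEStepBox` with `ResidueAtW ↦ ResidueOnUcAtW` in the LZ hypothesis, the inductive hypothesis and the conclusion): [I] Thm 3 at
scale `k+1` from (1.7)+(1.18)+(1.19) at scales `≤ k`, AS PRINT STATES THEM (on the domains).  OPEN (XXL); inhabited nowhere; a CANDIDATE letter.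
[cite: Balaban1987RG1, Thm 3 p.264, p.268 L27–31, (1.7) p.261, p.263 L3–6, (2.12)–(2.14) p.268; Balaban1988RG2Cluster, (1.34) p.9, p.22 L1–5] -/
def FEStepUc (F : T4Family) : Prop :=
  ∃ Mth : ℕ, ∀ Mc : ℕ, Mth ≤ Mc → ∀ (j c c₀ c₁ : ℕ) (B₃ B₃' a₀ a₁ : ℝ), Summit.QuantumFields.YangMills.Theorems.K0RecordFormatNames.McGuard F Mc → c ≤ F.L ^ j → c₀ ≤ j + 1 → c₁ ≤ j → 2 * (F.L : ℝ) ^ 2 ≤ B₃ → 0 < B₃' → 0 < a₀ → 0 < a₁ → Literature.MathematicalPhysics.QuantumFieldTheory.Balaban1983to89.Node00.VariationalThm1RegSepCoP7MGB F 2 (fun ν M g K k _s => c ≤ ν.M₁ ∧ k + c₀ ≤ F.m + K ∧ F.L ^ c₁ ∣ M ∧ ∀ i, 1 ≤ i → i ≤ k → Literature.MathematicalPhysics.QuantumFieldTheory.Balaban1983to89.Node00.dCubeSide (F.P K).L M (Literature.MathematicalPhysics.QuantumFieldTheory.Balaban1983to89.Node00.RkOfRecord (F.P K).L ν.r (g i))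 i ∣ (F.P K).sitesPerDir 0) (Literature.MathematicalPhysics.QuantumFieldTheory.Balaban1983to89.Node00.lamDatum F) (Literature.MathematicalPhysics.QuantumFieldTheory.Balaban1983to89.Node00.dataSmall7LamTopOf F 2) B₃ a₀ a₁ → Literature.MathematicalPhysics.QuantumFieldTheory.Balaban1983to89.Node00.Gauge9RegSepTopStepGB F 2 (fun ν K Ω => Literature.MathematicalPhysics.QuantumFieldTheory.Balaban1983to89.Node00.suppDomOfRecord F ν K Ω) (F.L ^ j) (fun ν M g K k _s => c ≤ ν.M₁ ∧ k + c₀ ≤ F.m + K ∧ F.L ^ c₁ ∣ M ∧ ∀ i, 1 ≤ i → i ≤ k → Literature.MathematicalPhysics.QuantumFieldTheory.Balaban1983to89.Node00.dCubeSide (F.P K).L M (Literature.MathematicalPhysics.QuantumFieldTheory.Balaban1983to89.Node00.RkOfRecord (F.P K).L ν.r (g i)) i ∣ (F.P K).sitesPerDir 0) (Literature.MathematicalPhysics.QuantumFieldTheory.Balaban1983to89.Node00.lamDatum F) (Literature.MathematicalPhysics.QuantumFieldTheory.Balaban1983to89.Node00.dataSmall7LamTopOf F 2) B₃ B₃' a₀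 a₁ → (∀ ε₁ : ℝ, 0 < ε₁ → ε₁ ≤ a₁ → B₃ * ε₁ ≤ a₀ → ∀ (k n : ℕ) (V : Literature.MathematicalPhysics.QuantumFieldTheory.Balaban1983to89.GaugeField (F.P (Summit.QuantumFields.YangMills.Theorems.K0RecordFormatNames.recordK₀ F Mc k + n)) (k + 1) (Literature.MathematicalPhysics.QuantumFieldTheory.Balaban1983to89.Node00.SU 2)), Literature.MathematicalPhysics.QuantumFieldTheory.Balaban1983to89.PlaqSmall ε₁ V → Literature.MathematicalPhysics.QuantumFieldTheory.Balaban1983to89.Node00.UkExists F 2 (Summit.QuantumFields.YangMills.Theorems.K0RecordFormatNames.recordK₀ F Mc k + n) (k + 1) a₀ V ∧ Literature.MathematicalPhysics.QuantumFieldTheory.Balaban1983to89.Node00.UniqueUkOrbit F 2 (Summit.QuantumFields.YangMills.Theorems.K0RecordFormatNames.recordK₀ F Mc k + n) (k + 1) a₀ V) → (∀ (k n : ℕ) (ε₂₉ : ℝ), 0 < ε₂₉ → letI θ := Summit.QuantumFields.YangMills.Theorems.K0RecordFormatNames.thetaFill F a₀ ε₂₉; letI := θ.instVβ₁; letI :=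 θ.instVβ₂; letI := θ.instιβ; AnalyticAt ℝ (fun B : Summit.QuantumFields.YangMills.Theorems.K0RecordFormatNames.recordW F a₀ ε₂₉ k (Summit.QuantumFields.YangMills.Theorems.K0RecordFormatNames.recordK₀ F Mc k + n) => fun (b : Literature.MathematicalPhysics.QuantumFieldTheory.Balaban1983to89.PBond (F.P (Summit.QuantumFields.YangMills.Theorems.K0RecordFormatNames.recordK₀ F Mc k + n)) 0) (i i' : Fin 2) => ((Summit.QuantumFields.YangMills.Theorems.K0RecordFormatNames.recordBgField F θ k (Summit.QuantumFields.YangMills.Theorems.K0RecordFormatNames.recordK₀ F Mc k + n) B b : Literature.MathematicalPhysics.QuantumFieldTheory.Balaban1983to89.Node00.SU 2) : Matrix (Fin 2) (Fin 2) ℂ) i i') 0) → (∃ C₉' δ₉ : ℝ, 0 ≤ C₉' ∧ 0 < δ₉ ∧ ∀ (k n : ℕ) (ε₂₉ : ℝ), 0 < ε₂₉ → letI θ := Summit.QuantumFields.YangMills.Theorems.K0RecordFormatNames.thetaFill F a₀ ε₂₉; letI := θ.instVβ₁; letI := θ.instVβ₂; letI := θ.instιβ; ∀ (a : θ.ιβ)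 (μ : Fin (F.P (Summit.QuantumFields.YangMills.Theorems.K0RecordFormatNames.recordK₀ F Mc k + n)).d) (y : Literature.MathematicalPhysics.QuantumFieldTheory.Balaban1983to89.Site (F.P (Summit.QuantumFields.YangMills.Theorems.K0RecordFormatNames.recordK₀ F Mc k + n)) (k + 1)), letI D := fderiv ℝ (fun B : Summit.QuantumFields.YangMills.Theorems.K0RecordFormatNames.recordW F a₀ ε₂₉ k (Summit.QuantumFields.YangMills.Theorems.K0RecordFormatNames.recordK₀ F Mc k + n) => fun (b : Literature.MathematicalPhysics.QuantumFieldTheory.Balaban1983to89.PBond (F.P (Summit.QuantumFields.YangMills.Theorems.K0RecordFormatNames.recordK₀ F Mc k + n)) 0) (i i' : Fin 2) => ((Summit.QuantumFields.YangMills.Theorems.K0RecordFormatNames.recordBgField F θ k (Summit.QuantumFields.YangMills.Theorems.K0RecordFormatNames.recordK₀ F Mc k + n) B b : Literature.MathematicalPhysics.QuantumFieldTheory.Balaban1983to89.Node00.SU 2) : Matrix (Fin 2) (Fin 2) ℂ) i i') 0 (Pi.single μ (Pi.single y (θ.bV a))); ∃ (Hr : Literature.MathematicalPhysics.QuantumFieldTheory.Balaban1983to89.PBond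 (F.P (Summit.QuantumFields.YangMills.Theorems.K0RecordFormatNames.recordK₀ F Mc k + n)) 0 → Fin 2 → Fin 2 → ℂ) (φ : Literature.MathematicalPhysics.QuantumFieldTheory.Balaban1983to89.Site (F.P (Summit.QuantumFields.YangMills.Theorems.K0RecordFormatNames.recordK₀ F Mc k + n)) 0 → Fin 2 → Fin 2 → ℂ), (∀ b : Literature.MathematicalPhysics.QuantumFieldTheory.Balaban1983to89.PBond (F.P (Summit.QuantumFields.YangMills.Theorems.K0RecordFormatNames.recordK₀ F Mc k + n)) 0, D b = Hr b + (φ b.src - φ (b.src.shift b.dir))) ∧ (∃ μc : Literature.MathematicalPhysics.QuantumFieldTheory.Balaban1983to89.Site (F.P (Summit.QuantumFields.YangMills.Theorems.K0RecordFormatNames.recordK₀ F Mc k + n)) (k + 1) → Fin 2 → Fin 2 → ℂ, ∀ x : Literature.MathematicalPhysics.QuantumFieldTheory.Balaban1983to89.Site (F.P (Summit.QuantumFields.YangMills.Theorems.K0RecordFormatNames.recordK₀ F Mc k + n)) 0, letI dv := (fun x' : Literature.MathematicalPhysics.QuantumFieldTheory.Balaban1983to89.Site (F.P (Summit.QuantumFields.YangMills.Theorems.K0RecordFormatNames.recordK₀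 F Mc k + n)) 0 => ∑ ν : Fin (F.P (Summit.QuantumFields.YangMills.Theorems.K0RecordFormatNames.recordK₀ F Mc k + n)).d, (Hr ⟨x', ν⟩ - Hr ⟨x'.unshift ν, ν⟩)); ∑ ν : Fin (F.P (Summit.QuantumFields.YangMills.Theorems.K0RecordFormatNames.recordK₀ F Mc k + n)).d, (dv (x.shift ν) - (2 : ℂ) • dv x + dv (x.unshift ν)) = μc (Summit.QuantumFields.YangMills.Theorems.K0RecordFormatNames.coarsenTo (k + 1) x)) ∧ ∀ b : Literature.MathematicalPhysics.QuantumFieldTheory.Balaban1983to89.PBond (F.P (Summit.QuantumFields.YangMills.Theorems.K0RecordFormatNames.recordK₀ F Mc k + n)) 0, ‖Hr b‖ ≤ C₉' * (F.P (Summit.QuantumFields.YangMills.Theorems.K0RecordFormatNames.recordK₀ F Mc k + n)).eta (k + 1) * Real.exp (-(δ₉ * (Literature.MathematicalPhysics.QuantumFieldTheory.Balaban1983to89.Site.tdist (Summit.QuantumFields.YangMills.Theorems.K0RecordFormatNames.coarsenTo (k + 1) b.src) y : ℝ))) ∧ (∀ ν : Fin (F.P (Summit.QuantumFields.YangMills.Theorems.K0RecordFormatNames.recordK₀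 F Mc k + n)).d, ‖Hr (⟨b.src.shift ν, b.dir⟩ : Literature.MathematicalPhysics.QuantumFieldTheory.Balaban1983to89.PBond (F.P (Summit.QuantumFields.YangMills.Theorems.K0RecordFormatNames.recordK₀ F Mc k + n)) 0) - Hr b‖ ≤ C₉' * (F.P (Summit.QuantumFields.YangMills.Theorems.K0RecordFormatNames.recordK₀ F Mc k + n)).eta (k + 1) ^ 2 * Real.exp (-(δ₉ * (Literature.MathematicalPhysics.QuantumFieldTheory.Balaban1983to89.Site.tdist (Summit.QuantumFields.YangMills.Theorems.K0RecordFormatNames.coarsenTo (k + 1) b.src) y : ℝ)))) ∧ ‖∑ ν : Fin (F.P (Summit.QuantumFields.YangMills.Theorems.K0RecordFormatNames.recordK₀ F Mc k + n)).d, (Hr (⟨b.src.shift ν, b.dir⟩ : Literature.MathematicalPhysics.QuantumFieldTheory.Balaban1983to89.PBond (F.P (Summit.QuantumFields.YangMills.Theorems.K0RecordFormatNames.recordK₀ F Mc k + n)) 0) - (2 : ℂ) • Hr b + Hr (⟨b.src.unshift ν, b.dir⟩ : Literature.MathematicalPhysics.QuantumFieldTheory.Balaban1983to89.PBond (F.P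 (Summit.QuantumFields.YangMills.Theorems.K0RecordFormatNames.recordK₀ F Mc k + n)) 0))‖ ≤ C₉' * (F.P (Summit.QuantumFields.YangMills.Theorems.K0RecordFormatNames.recordK₀ F Mc k + n)).eta (k + 1) ^ 3 * Real.exp (-(δ₉ * (Literature.MathematicalPhysics.QuantumFieldTheory.Balaban1983to89.Site.tdist (Summit.QuantumFields.YangMills.Theorems.K0RecordFormatNames.coarsenTo (k + 1) b.src) y : ℝ))) ∧ ‖∑ ν : Fin (F.P (Summit.QuantumFields.YangMills.Theorems.K0RecordFormatNames.recordK₀ F Mc k + n)).d, ((Hr (⟨b.src, b.dir⟩ : Literature.MathematicalPhysics.QuantumFieldTheory.Balaban1983to89.PBond (F.P (Summit.QuantumFields.YangMills.Theorems.K0RecordFormatNames.recordK₀ F Mc k + n)) 0) + Hr (⟨(b.src).shift b.dir, ν⟩ : Literature.MathematicalPhysics.QuantumFieldTheory.Balaban1983to89.PBond (F.P (Summit.QuantumFields.YangMills.Theorems.K0RecordFormatNames.recordK₀ F Mc k + n)) 0) - Hr (⟨(b.src).shift ν, b.dir⟩ : Literature.MathematicalPhysics.QuantumFieldTheory.Balaban1983to89.PBond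 (F.P (Summit.QuantumFields.YangMills.Theorems.K0RecordFormatNames.recordK₀ F Mc k + n)) 0) - Hr (⟨b.src, ν⟩ : Literature.MathematicalPhysics.QuantumFieldTheory.Balaban1983to89.PBond (F.P (Summit.QuantumFields.YangMills.Theorems.K0RecordFormatNames.recordK₀ F Mc k + n)) 0)) - (Hr (⟨b.src.unshift ν, b.dir⟩ : Literature.MathematicalPhysics.QuantumFieldTheory.Balaban1983to89.PBond (F.P (Summit.QuantumFields.YangMills.Theorems.K0RecordFormatNames.recordK₀ F Mc k + n)) 0) + Hr (⟨(b.src.unshift ν).shift b.dir, ν⟩ : Literature.MathematicalPhysics.QuantumFieldTheory.Balaban1983to89.PBond (F.P (Summit.QuantumFields.YangMills.Theorems.K0RecordFormatNames.recordK₀ F Mc k + n)) 0) - Hr (⟨(b.src.unshift ν).shift ν, b.dir⟩ : Literature.MathematicalPhysics.QuantumFieldTheory.Balaban1983to89.PBond (F.P (Summit.QuantumFields.YangMills.Theorems.K0RecordFormatNames.recordK₀ F Mc k + n)) 0) - Hr (⟨b.src.unshift ν, ν⟩ : Literature.MathematicalPhysics.QuantumFieldTheory.Balaban1983to89.PBond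 (F.P (Summit.QuantumFields.YangMills.Theorems.K0RecordFormatNames.recordK₀ F Mc k + n)) 0)))‖ ≤ C₉' * (F.P (Summit.QuantumFields.YangMills.Theorems.K0RecordFormatNames.recordK₀ F Mc k + n)).eta (k + 1) ^ 3 * Real.exp (-(δ₉ * (Literature.MathematicalPhysics.QuantumFieldTheory.Balaban1983to89.Site.tdist (Summit.QuantumFields.YangMills.Theorems.K0RecordFormatNames.coarsenTo (k + 1) b.src) y : ℝ)))) → ∃ ε₂₉ : ℝ, 0 < ε₂₉ ∧ ∀ (E₁ κ₁ β₀ β₁ : ℝ), 0 ≤ E₁ → 4 * Literature.MathematicalPhysics.QuantumFieldTheory.Balaban1983to89.B12TreeDecay.kappa₀ (4 * 2 ^ 4) (2 * 4) ≤ κ₁ → 0 < β₀ → 0 < β₁ → (∀ k : ℕ, Summit.QuantumFields.YangMills.Theorems.BalabanUVNodesPortS1.LZResidueUcAt F Mc a₀ ε₂₉ β₀ β₁ E₁ κ₁ k) → ∃ γ₀ E₂ κ α₀ α₁ : ℝ, 0 < γ₀ ∧ 0 ≤ E₂ ∧ 4 * Literature.MathematicalPhysics.QuantumFieldTheory.Balaban1983to89.B12TreeDecay.kappa₀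 (4 * 2 ^ 4) (2 * 4) ≤ κ ∧ 0 < α₀ ∧ 0 < α₁ ∧ ∀ k : ℕ, (∀ j : ℕ, j < k → Summit.QuantumFields.YangMills.Theorems.BalabanUVNodesPortS1.FEResidueUcBoxAt F Mc a₀ ε₂₉ γ₀ α₀ α₁ E₂ κ j) → Summit.QuantumFields.YangMills.Theorems.BalabanUVNodesPortS1.FEResidueUcBoxAt F Mc a₀ ε₂₉ γ₀ α₀ α₁ E₂ κ k

/-- **`PortRecordLZHalfUc F` — THE LZ HALF, DOMAIN-WIDE EDITION** (✓`PortRecordLZHalf` with `ResidueAtW ↦ ResidueOnUcAtW`): the explicit `log Z^{(k)}` bracket is represented wherever its power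
series ∕ walk expansions converge — the landed LZ files prove the germ edition; the strengthening is located, NOT done here.  OPEN as a letter. [cite: Balaban1987RG1, (1.4) p.260, (1.7) p.261; Balaban1985UV3, (63) p.272] -/
def PortRecordLZHalfUc (F : T4Family) : Prop :=
  ∃ Mth : ℕ, ∀ Mc : ℕ, Mth ≤ Mc → ∀ (j c c₀ c₁ : ℕ) (B₃ B₃' a₀ a₁ : ℝ), Summit.QuantumFields.YangMills.Theorems.K0RecordFormatNames.McGuard F Mc → c ≤ F.L ^ j → c₀ ≤ j + 1 → c₁ ≤ j → 2 * (F.L : ℝ) ^ 2 ≤ B₃ → 0 < B₃' → 0 < a₀ → 0 < a₁ → Literature.MathematicalPhysics.QuantumFieldTheory.Balaban1983to89.Node00.VariationalThm1RegSepCoP7MGB F 2 (fun ν M g K k _s => c ≤ ν.M₁ ∧ k + c₀ ≤ F.m + K ∧ F.L ^ c₁ ∣ M ∧ ∀ i, 1 ≤ i → i ≤ k → Literature.MathematicalPhysics.QuantumFieldTheory.Balaban1983to89.Node00.dCubeSide (F.P K).L M (Literature.MathematicalPhysics.QuantumFieldTheory.Balaban1983to89.Node00.RkOfRecord (F.P K).L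 ν.r (g i)) i ∣ (F.P K).sitesPerDir 0) (Literature.MathematicalPhysics.QuantumFieldTheory.Balaban1983to89.Node00.lamDatum F) (Literature.MathematicalPhysics.QuantumFieldTheory.Balaban1983to89.Node00.dataSmall7LamTopOf F 2) B₃ a₀ a₁ → Literature.MathematicalPhysics.QuantumFieldTheory.Balaban1983to89.Node00.Gauge9RegSepTopStepGB F 2 (fun ν K Ω => Literature.MathematicalPhysics.QuantumFieldTheory.Balaban1983to89.Node00.suppDomOfRecord F ν K Ω) (F.L ^ j) (fun ν M g K k _s => c ≤ ν.M₁ ∧ k + c₀ ≤ F.m + K ∧ F.L ^ c₁ ∣ M ∧ ∀ i, 1 ≤ i → i ≤ k → Literature.MathematicalPhysics.QuantumFieldTheory.Balaban1983to89.Node00.dCubeSide (F.P K).L M (Literature.MathematicalPhysics.QuantumFieldTheory.Balaban1983to89.Node00.RkOfRecord (F.P K).L ν.r (g i)) i ∣ (F.P K).sitesPerDir 0) (Literature.MathematicalPhysics.QuantumFieldTheory.Balaban1983to89.Node00.lamDatum F) (Literature.MathematicalPhysics.QuantumFieldTheory.Balaban1983to89.Node00.dataSmall7LamTopOf F 2)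 B₃ B₃' a₀ a₁ → (∀ ε₁ : ℝ, 0 < ε₁ → ε₁ ≤ a₁ → B₃ * ε₁ ≤ a₀ → ∀ (k n : ℕ) (V : Literature.MathematicalPhysics.QuantumFieldTheory.Balaban1983to89.GaugeField (F.P (Summit.QuantumFields.YangMills.Theorems.K0RecordFormatNames.recordK₀ F Mc k + n)) (k + 1) (Literature.MathematicalPhysics.QuantumFieldTheory.Balaban1983to89.Node00.SU 2)), Literature.MathematicalPhysics.QuantumFieldTheory.Balaban1983to89.PlaqSmall ε₁ V → Literature.MathematicalPhysics.QuantumFieldTheory.Balaban1983to89.Node00.UkExists F 2 (Summit.QuantumFields.YangMills.Theorems.K0RecordFormatNames.recordK₀ F Mc k + n) (k + 1) a₀ V ∧ Literature.MathematicalPhysics.QuantumFieldTheory.Balaban1983to89.Node00.UniqueUkOrbit F 2 (Summit.QuantumFields.YangMills.Theorems.K0RecordFormatNames.recordK₀ F Mc k + n) (k + 1) a₀ V) → (∀ (k n : ℕ) (ε₂₉ : ℝ), 0 < ε₂₉ → letI θ := Summit.QuantumFields.YangMills.Theorems.K0RecordFormatNames.thetaFill F a₀ ε₂₉; letI := θ.instVβ₁;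 letI := θ.instVβ₂; letI := θ.instιβ; AnalyticAt ℝ (fun B : Summit.QuantumFields.YangMills.Theorems.K0RecordFormatNames.recordW F a₀ ε₂₉ k (Summit.QuantumFields.YangMills.Theorems.K0RecordFormatNames.recordK₀ F Mc k + n) => fun (b : Literature.MathematicalPhysics.QuantumFieldTheory.Balaban1983to89.PBond (F.P (Summit.QuantumFields.YangMills.Theorems.K0RecordFormatNames.recordK₀ F Mc k + n)) 0) (i i' : Fin 2) => ((Summit.QuantumFields.YangMills.Theorems.K0RecordFormatNames.recordBgField F θ k (Summit.QuantumFields.YangMills.Theorems.K0RecordFormatNames.recordK₀ F Mc k + n) B b : Literature.MathematicalPhysics.QuantumFieldTheory.Balaban1983to89.Node00.SU 2) : Matrix (Fin 2) (Fin 2) ℂ) i i') 0) → (∃ C₉' δ₉ : ℝ, 0 ≤ C₉' ∧ 0 < δ₉ ∧ ∀ (k n : ℕ) (ε₂₉ : ℝ), 0 < ε₂₉ → letI θ := Summit.QuantumFields.YangMills.Theorems.K0RecordFormatNames.thetaFill F a₀ ε₂₉; letI := θ.instVβ₁; letI := θ.instVβ₂; letI := θ.instιβ; ∀ (a : θ.ιβ)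 (μ : Fin (F.P (Summit.QuantumFields.YangMills.Theorems.K0RecordFormatNames.recordK₀ F Mc k + n)).d) (y : Literature.MathematicalPhysics.QuantumFieldTheory.Balaban1983to89.Site (F.P (Summit.QuantumFields.YangMills.Theorems.K0RecordFormatNames.recordK₀ F Mc k + n)) (k + 1)), letI D := fderiv ℝ (fun B : Summit.QuantumFields.YangMills.Theorems.K0RecordFormatNames.recordW F a₀ ε₂₉ k (Summit.QuantumFields.YangMills.Theorems.K0RecordFormatNames.recordK₀ F Mc k + n) => fun (b : Literature.MathematicalPhysics.QuantumFieldTheory.Balaban1983to89.PBond (F.P (Summit.QuantumFields.YangMills.Theorems.K0RecordFormatNames.recordK₀ F Mc k + n)) 0) (i i' : Fin 2) => ((Summit.QuantumFields.YangMills.Theorems.K0RecordFormatNames.recordBgField F θ k (Summit.QuantumFields.YangMills.Theorems.K0RecordFormatNames.recordK₀ F Mc k + n) B b : Literature.MathematicalPhysics.QuantumFieldTheory.Balaban1983to89.Node00.SU 2) : Matrix (Fin 2) (Fin 2) ℂ) i i') 0 (Pi.single μ (Pi.single y (θ.bV a))); ∃ (Hr : Literature.MathematicalPhysics.QuantumFieldTheory.Balaban1983to89.PBond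 (F.P (Summit.QuantumFields.YangMills.Theorems.K0RecordFormatNames.recordK₀ F Mc k + n)) 0 → Fin 2 → Fin 2 → ℂ) (φ : Literature.MathematicalPhysics.QuantumFieldTheory.Balaban1983to89.Site (F.P (Summit.QuantumFields.YangMills.Theorems.K0RecordFormatNames.recordK₀ F Mc k + n)) 0 → Fin 2 → Fin 2 → ℂ), (∀ b : Literature.MathematicalPhysics.QuantumFieldTheory.Balaban1983to89.PBond (F.P (Summit.QuantumFields.YangMills.Theorems.K0RecordFormatNames.recordK₀ F Mc k + n)) 0, D b = Hr b + (φ b.src - φ (b.src.shift b.dir))) ∧ (∃ μc : Literature.MathematicalPhysics.QuantumFieldTheory.Balaban1983to89.Site (F.P (Summit.QuantumFields.YangMills.Theorems.K0RecordFormatNames.recordK₀ F Mc k + n)) (k + 1) → Fin 2 → Fin 2 → ℂ, ∀ x : Literature.MathematicalPhysics.QuantumFieldTheory.Balaban1983to89.Site (F.P (Summit.QuantumFields.YangMills.Theorems.K0RecordFormatNames.recordK₀ F Mc k + n)) 0, letI dv := (fun x' : Literature.MathematicalPhysics.QuantumFieldTheory.Balaban1983to89.Site (F.P (Summit.QuantumFields.YangMills.Theorems.K0RecordFormatNames.recordK₀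 F Mc k + n)) 0 => ∑ ν : Fin (F.P (Summit.QuantumFields.YangMills.Theorems.K0RecordFormatNames.recordK₀ F Mc k + n)).d, (Hr ⟨x', ν⟩ - Hr ⟨x'.unshift ν, ν⟩)); ∑ ν : Fin (F.P (Summit.QuantumFields.YangMills.Theorems.K0RecordFormatNames.recordK₀ F Mc k + n)).d, (dv (x.shift ν) - (2 : ℂ) • dv x + dv (x.unshift ν)) = μc (Summit.QuantumFields.YangMills.Theorems.K0RecordFormatNames.coarsenTo (k + 1) x)) ∧ ∀ b : Literature.MathematicalPhysics.QuantumFieldTheory.Balaban1983to89.PBond (F.P (Summit.QuantumFields.YangMills.Theorems.K0RecordFormatNames.recordK₀ F Mc k + n)) 0, ‖Hr b‖ ≤ C₉' * (F.P (Summit.QuantumFields.YangMills.Theorems.K0RecordFormatNames.recordK₀ F Mc k + n)).eta (k + 1) * Real.exp (-(δ₉ * (Literature.MathematicalPhysics.QuantumFieldTheory.Balaban1983to89.Site.tdist (Summit.QuantumFields.YangMills.Theorems.K0RecordFormatNames.coarsenTo (k + 1) b.src) y : ℝ))) ∧ (∀ ν : Fin (F.P (Summit.QuantumFields.YangMills.Theorems.K0RecordFormatNames.recordK₀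 F Mc k + n)).d, ‖Hr (⟨b.src.shift ν, b.dir⟩ : Literature.MathematicalPhysics.QuantumFieldTheory.Balaban1983to89.PBond (F.P (Summit.QuantumFields.YangMills.Theorems.K0RecordFormatNames.recordK₀ F Mc k + n)) 0) - Hr b‖ ≤ C₉' * (F.P (Summit.QuantumFields.YangMills.Theorems.K0RecordFormatNames.recordK₀ F Mc k + n)).eta (k + 1) ^ 2 * Real.exp (-(δ₉ * (Literature.MathematicalPhysics.QuantumFieldTheory.Balaban1983to89.Site.tdist (Summit.QuantumFields.YangMills.Theorems.K0RecordFormatNames.coarsenTo (k + 1) b.src) y : ℝ)))) ∧ ‖∑ ν : Fin (F.P (Summit.QuantumFields.YangMills.Theorems.K0RecordFormatNames.recordK₀ F Mc k + n)).d, (Hr (⟨b.src.shift ν, b.dir⟩ : Literature.MathematicalPhysics.QuantumFieldTheory.Balaban1983to89.PBond (F.P (Summit.QuantumFields.YangMills.Theorems.K0RecordFormatNames.recordK₀ F Mc k + n)) 0) - (2 : ℂ) • Hr b + Hr (⟨b.src.unshift ν, b.dir⟩ : Literature.MathematicalPhysics.QuantumFieldTheory.Balaban1983to89.PBond (F.P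 (Summit.QuantumFields.YangMills.Theorems.K0RecordFormatNames.recordK₀ F Mc k + n)) 0))‖ ≤ C₉' * (F.P (Summit.QuantumFields.YangMills.Theorems.K0RecordFormatNames.recordK₀ F Mc k + n)).eta (k + 1) ^ 3 * Real.exp (-(δ₉ * (Literature.MathematicalPhysics.QuantumFieldTheory.Balaban1983to89.Site.tdist (Summit.QuantumFields.YangMills.Theorems.K0RecordFormatNames.coarsenTo (k + 1) b.src) y : ℝ))) ∧ ‖∑ ν : Fin (F.P (Summit.QuantumFields.YangMills.Theorems.K0RecordFormatNames.recordK₀ F Mc k + n)).d, ((Hr (⟨b.src, b.dir⟩ : Literature.MathematicalPhysics.QuantumFieldTheory.Balaban1983to89.PBond (F.P (Summit.QuantumFields.YangMills.Theorems.K0RecordFormatNames.recordK₀ F Mc k + n)) 0) + Hr (⟨(b.src).shift b.dir, ν⟩ : Literature.MathematicalPhysics.QuantumFieldTheory.Balaban1983to89.PBond (F.P (Summit.QuantumFields.YangMills.Theorems.K0RecordFormatNames.recordK₀ F Mc k + n)) 0) - Hr (⟨(b.src).shift ν, b.dir⟩ : Literature.MathematicalPhysics.QuantumFieldTheory.Balaban1983to89.PBond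 (F.P (Summit.QuantumFields.YangMills.Theorems.K0RecordFormatNames.recordK₀ F Mc k + n)) 0) - Hr (⟨b.src, ν⟩ : Literature.MathematicalPhysics.QuantumFieldTheory.Balaban1983to89.PBond (F.P (Summit.QuantumFields.YangMills.Theorems.K0RecordFormatNames.recordK₀ F Mc k + n)) 0)) - (Hr (⟨b.src.unshift ν, b.dir⟩ : Literature.MathematicalPhysics.QuantumFieldTheory.Balaban1983to89.PBond (F.P (Summit.QuantumFields.YangMills.Theorems.K0RecordFormatNames.recordK₀ F Mc k + n)) 0) + Hr (⟨(b.src.unshift ν).shift b.dir, ν⟩ : Literature.MathematicalPhysics.QuantumFieldTheory.Balaban1983to89.PBond (F.P (Summit.QuantumFields.YangMills.Theorems.K0RecordFormatNames.recordK₀ F Mc k + n)) 0) - Hr (⟨(b.src.unshift ν).shift ν, b.dir⟩ : Literature.MathematicalPhysics.QuantumFieldTheory.Balaban1983to89.PBond (F.P (Summit.QuantumFields.YangMills.Theorems.K0RecordFormatNames.recordK₀ F Mc k + n)) 0) - Hr (⟨b.src.unshift ν, ν⟩ : Literature.MathematicalPhysics.QuantumFieldTheory.Balaban1983to89.PBond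 (F.P (Summit.QuantumFields.YangMills.Theorems.K0RecordFormatNames.recordK₀ F Mc k + n)) 0)))‖ ≤ C₉' * (F.P (Summit.QuantumFields.YangMills.Theorems.K0RecordFormatNames.recordK₀ F Mc k + n)).eta (k + 1) ^ 3 * Real.exp (-(δ₉ * (Literature.MathematicalPhysics.QuantumFieldTheory.Balaban1983to89.Site.tdist (Summit.QuantumFields.YangMills.Theorems.K0RecordFormatNames.coarsenTo (k + 1) b.src) y : ℝ)))) → ∀ ε₂₉ : ℝ, 0 < ε₂₉ → ∃ E₁ κ α₀ α₁ : ℝ, 0 ≤ E₁ ∧ 4 * Literature.MathematicalPhysics.QuantumFieldTheory.Balaban1983to89.B12TreeDecay.kappa₀ (4 * 2 ^ 4) (2 * 4) ≤ κ ∧ 0 < α₀ ∧ 0 < α₁ ∧ ∀ k : ℕ, Summit.QuantumFields.YangMills.Theorems.BalabanUVNodesPortS1.LZResidueUcAt F Mc a₀ ε₂₉ α₀ α₁ E₁ κ k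

/-- **`CutsInUcNear F` — THE REGULARITY LETTER** (lens-1 R1∕Z1b): under the ⁸ antecedent, for every `ε₂₉ > 0` and all positive radii `α₀ α₁`, at every level and volume the charted data NEAR `B = 0`
lie in the domains — continuity of `B ↦ U_{k+1}(W_B)` at `0` (the antecedent's `hP9` gives analyticity there), openness of `recordUc`, and the unit pair inside.  OPEN as a letter (S–M); NOT proved here.
[cite: Balaban1987RG1, (1.11)–(1.16) pp.262–263, (1.1) p.260] -/
def CutsInUcNear (F : T4Family) : Prop :=
  ∃ Mth : ℕ, ∀ Mc : ℕ, Mth ≤ Mc → ∀ (j c c₀ c₁ : ℕ) (B₃ B₃' a₀ a₁ : ℝ), Summit.QuantumFields.YangMills.Theorems.K0RecordFormatNames.McGuard F Mc → c ≤ F.L ^ j → c₀ ≤ j + 1 → c₁ ≤ j → 2 * (F.L : ℝ) ^ 2 ≤ B₃ → 0 < B₃' → 0 < a₀ → 0 < a₁ → Literature.MathematicalPhysics.QuantumFieldTheory.Balaban1983to89.Node00.VariationalThm1RegSepCoP7MGB F 2 (fun ν M g K k _s => c ≤ ν.M₁ ∧ k + c₀ ≤ F.m + K ∧ F.L ^ c₁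 ∣ M ∧ ∀ i, 1 ≤ i → i ≤ k → Literature.MathematicalPhysics.QuantumFieldTheory.Balaban1983to89.Node00.dCubeSide (F.P K).L M (Literature.MathematicalPhysics.QuantumFieldTheory.Balaban1983to89.Node00.RkOfRecord (F.P K).L ν.r (g i)) i ∣ (F.P K).sitesPerDir 0) (Literature.MathematicalPhysics.QuantumFieldTheory.Balaban1983to89.Node00.lamDatum F) (Literature.MathematicalPhysics.QuantumFieldTheory.Balaban1983to89.Node00.dataSmall7LamTopOf F 2) B₃ a₀ a₁ → Literature.MathematicalPhysics.QuantumFieldTheory.Balaban1983to89.Node00.Gauge9RegSepTopStepGB F 2 (fun ν K Ω => Literature.MathematicalPhysics.QuantumFieldTheory.Balaban1983to89.Node00.suppDomOfRecord F ν K Ω) (F.L ^ j) (fun ν M g K k _s => c ≤ ν.M₁ ∧ k + c₀ ≤ F.m + K ∧ F.L ^ c₁ ∣ M ∧ ∀ i, 1 ≤ i → i ≤ k → Literature.MathematicalPhysics.QuantumFieldTheory.Balaban1983to89.Node00.dCubeSide (F.P K).L M (Literature.MathematicalPhysics.QuantumFieldTheory.Balaban1983to89.Node00.RkOfRecord (F.P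 K).L ν.r (g i)) i ∣ (F.P K).sitesPerDir 0) (Literature.MathematicalPhysics.QuantumFieldTheory.Balaban1983to89.Node00.lamDatum F) (Literature.MathematicalPhysics.QuantumFieldTheory.Balaban1983to89.Node00.dataSmall7LamTopOf F 2) B₃ B₃' a₀ a₁ → (∀ ε₁ : ℝ, 0 < ε₁ → ε₁ ≤ a₁ → B₃ * ε₁ ≤ a₀ → ∀ (k n : ℕ) (V : Literature.MathematicalPhysics.QuantumFieldTheory.Balaban1983to89.GaugeField (F.P (Summit.QuantumFields.YangMills.Theorems.K0RecordFormatNames.recordK₀ F Mc k + n)) (k + 1) (Literature.MathematicalPhysics.QuantumFieldTheory.Balaban1983to89.Node00.SU 2)), Literature.MathematicalPhysics.QuantumFieldTheory.Balaban1983to89.PlaqSmall ε₁ V → Literature.MathematicalPhysics.QuantumFieldTheory.Balaban1983to89.Node00.UkExists F 2 (Summit.QuantumFields.YangMills.Theorems.K0RecordFormatNames.recordK₀ F Mc k + n) (k + 1) a₀ V ∧ Literature.MathematicalPhysics.QuantumFieldTheory.Balaban1983to89.Node00.UniqueUkOrbit F 2 (Summit.QuantumFields.YangMills.Theorems.K0RecordFormatNames.recordK₀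 F Mc k + n) (k + 1) a₀ V) → (∀ (k n : ℕ) (ε₂₉ : ℝ), 0 < ε₂₉ → letI θ := Summit.QuantumFields.YangMills.Theorems.K0RecordFormatNames.thetaFill F a₀ ε₂₉; letI := θ.instVβ₁; letI := θ.instVβ₂; letI := θ.instιβ; AnalyticAt ℝ (fun B : Summit.QuantumFields.YangMills.Theorems.K0RecordFormatNames.recordW F a₀ ε₂₉ k (Summit.QuantumFields.YangMills.Theorems.K0RecordFormatNames.recordK₀ F Mc k + n) => fun (b : Literature.MathematicalPhysics.QuantumFieldTheory.Balaban1983to89.PBond (F.P (Summit.QuantumFields.YangMills.Theorems.K0RecordFormatNames.recordK₀ F Mc k + n)) 0) (i i' : Fin 2) => ((Summit.QuantumFields.YangMills.Theorems.K0RecordFormatNames.recordBgField F θ k (Summit.QuantumFields.YangMills.Theorems.K0RecordFormatNames.recordK₀ F Mc k + n) B b : Literature.MathematicalPhysics.QuantumFieldTheory.Balaban1983to89.Node00.SU 2) : Matrix (Fin 2) (Fin 2) ℂ) i i') 0) → (∃ C₉' δ₉ : ℝ, 0 ≤ C₉' ∧ 0 < δ₉ ∧ ∀ (k n : ℕ)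 (ε₂₉ : ℝ), 0 < ε₂₉ → letI θ := Summit.QuantumFields.YangMills.Theorems.K0RecordFormatNames.thetaFill F a₀ ε₂₉; letI := θ.instVβ₁; letI := θ.instVβ₂; letI := θ.instιβ; ∀ (a : θ.ιβ) (μ : Fin (F.P (Summit.QuantumFields.YangMills.Theorems.K0RecordFormatNames.recordK₀ F Mc k + n)).d) (y : Literature.MathematicalPhysics.QuantumFieldTheory.Balaban1983to89.Site (F.P (Summit.QuantumFields.YangMills.Theorems.K0RecordFormatNames.recordK₀ F Mc k + n)) (k + 1)), letI D := fderiv ℝ (fun B : Summit.QuantumFields.YangMills.Theorems.K0RecordFormatNames.recordW F a₀ ε₂₉ k (Summit.QuantumFields.YangMills.Theorems.K0RecordFormatNames.recordK₀ F Mc k + n) => fun (b : Literature.MathematicalPhysics.QuantumFieldTheory.Balaban1983to89.PBond (F.P (Summit.QuantumFields.YangMills.Theorems.K0RecordFormatNames.recordK₀ F Mc k + n)) 0) (i i' : Fin 2) => ((Summit.QuantumFields.YangMills.Theorems.K0RecordFormatNames.recordBgField F θ k (Summit.QuantumFields.YangMills.Theorems.K0RecordFormatNames.recordK₀ F Mc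 k + n) B b : Literature.MathematicalPhysics.QuantumFieldTheory.Balaban1983to89.Node00.SU 2) : Matrix (Fin 2) (Fin 2) ℂ) i i') 0 (Pi.single μ (Pi.single y (θ.bV a))); ∃ (Hr : Literature.MathematicalPhysics.QuantumFieldTheory.Balaban1983to89.PBond (F.P (Summit.QuantumFields.YangMills.Theorems.K0RecordFormatNames.recordK₀ F Mc k + n)) 0 → Fin 2 → Fin 2 → ℂ) (φ : Literature.MathematicalPhysics.QuantumFieldTheory.Balaban1983to89.Site (F.P (Summit.QuantumFields.YangMills.Theorems.K0RecordFormatNames.recordK₀ F Mc k + n)) 0 → Fin 2 → Fin 2 → ℂ), (∀ b : Literature.MathematicalPhysics.QuantumFieldTheory.Balaban1983to89.PBond (F.P (Summit.QuantumFields.YangMills.Theorems.K0RecordFormatNames.recordK₀ F Mc k + n)) 0, D b = Hr b + (φ b.src - φ (b.src.shift b.dir))) ∧ (∃ μc : Literature.MathematicalPhysics.QuantumFieldTheory.Balaban1983to89.Site (F.P (Summit.QuantumFields.YangMills.Theorems.K0RecordFormatNames.recordK₀ F Mc k + n)) (k + 1) → Fin 2 → Fin 2 → ℂ, ∀ x :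 Literature.MathematicalPhysics.QuantumFieldTheory.Balaban1983to89.Site (F.P (Summit.QuantumFields.YangMills.Theorems.K0RecordFormatNames.recordK₀ F Mc k + n)) 0, letI dv := (fun x' : Literature.MathematicalPhysics.QuantumFieldTheory.Balaban1983to89.Site (F.P (Summit.QuantumFields.YangMills.Theorems.K0RecordFormatNames.recordK₀ F Mc k + n)) 0 => ∑ ν : Fin (F.P (Summit.QuantumFields.YangMills.Theorems.K0RecordFormatNames.recordK₀ F Mc k + n)).d, (Hr ⟨x', ν⟩ - Hr ⟨x'.unshift ν, ν⟩)); ∑ ν : Fin (F.P (Summit.QuantumFields.YangMills.Theorems.K0RecordFormatNames.recordK₀ F Mc k + n)).d, (dv (x.shift ν) - (2 : ℂ) • dv x + dv (x.unshift ν)) = μc (Summit.QuantumFields.YangMills.Theorems.K0RecordFormatNames.coarsenTo (k + 1) x)) ∧ ∀ b : Literature.MathematicalPhysics.QuantumFieldTheory.Balaban1983to89.PBond (F.P (Summit.QuantumFields.YangMills.Theorems.K0RecordFormatNames.recordK₀ F Mc k + n)) 0, ‖Hr b‖ ≤ C₉' * (F.P (Summit.QuantumFields.YangMills.Theorems.K0RecordFormatNames.recordK₀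 F Mc k + n)).eta (k + 1) * Real.exp (-(δ₉ * (Literature.MathematicalPhysics.QuantumFieldTheory.Balaban1983to89.Site.tdist (Summit.QuantumFields.YangMills.Theorems.K0RecordFormatNames.coarsenTo (k + 1) b.src) y : ℝ))) ∧ (∀ ν : Fin (F.P (Summit.QuantumFields.YangMills.Theorems.K0RecordFormatNames.recordK₀ F Mc k + n)).d, ‖Hr (⟨b.src.shift ν, b.dir⟩ : Literature.MathematicalPhysics.QuantumFieldTheory.Balaban1983to89.PBond (F.P (Summit.QuantumFields.YangMills.Theorems.K0RecordFormatNames.recordK₀ F Mc k + n)) 0) - Hr b‖ ≤ C₉' * (F.P (Summit.QuantumFields.YangMills.Theorems.K0RecordFormatNames.recordK₀ F Mc k + n)).eta (k + 1) ^ 2 * Real.exp (-(δ₉ * (Literature.MathematicalPhysics.QuantumFieldTheory.Balaban1983to89.Site.tdist (Summit.QuantumFields.YangMills.Theorems.K0RecordFormatNames.coarsenTo (k + 1) b.src) y : ℝ)))) ∧ ‖∑ ν : Fin (F.P (Summit.QuantumFields.YangMills.Theorems.K0RecordFormatNames.recordK₀ F Mc k + n)).d, (Hr (⟨b.src.shift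 ν, b.dir⟩ : Literature.MathematicalPhysics.QuantumFieldTheory.Balaban1983to89.PBond (F.P (Summit.QuantumFields.YangMills.Theorems.K0RecordFormatNames.recordK₀ F Mc k + n)) 0) - (2 : ℂ) • Hr b + Hr (⟨b.src.unshift ν, b.dir⟩ : Literature.MathematicalPhysics.QuantumFieldTheory.Balaban1983to89.PBond (F.P (Summit.QuantumFields.YangMills.Theorems.K0RecordFormatNames.recordK₀ F Mc k + n)) 0))‖ ≤ C₉' * (F.P (Summit.QuantumFields.YangMills.Theorems.K0RecordFormatNames.recordK₀ F Mc k + n)).eta (k + 1) ^ 3 * Real.exp (-(δ₉ * (Literature.MathematicalPhysics.QuantumFieldTheory.Balaban1983to89.Site.tdist (Summit.QuantumFields.YangMills.Theorems.K0RecordFormatNames.coarsenTo (k + 1) b.src) y : ℝ))) ∧ ‖∑ ν : Fin (F.P (Summit.QuantumFields.YangMills.Theorems.K0RecordFormatNames.recordK₀ F Mc k + n)).d, ((Hr (⟨b.src, b.dir⟩ : Literature.MathematicalPhysics.QuantumFieldTheory.Balaban1983to89.PBond (F.P (Summit.QuantumFields.YangMills.Theorems.K0RecordFormatNames.recordK₀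 F Mc k + n)) 0) + Hr (⟨(b.src).shift b.dir, ν⟩ : Literature.MathematicalPhysics.QuantumFieldTheory.Balaban1983to89.PBond (F.P (Summit.QuantumFields.YangMills.Theorems.K0RecordFormatNames.recordK₀ F Mc k + n)) 0) - Hr (⟨(b.src).shift ν, b.dir⟩ : Literature.MathematicalPhysics.QuantumFieldTheory.Balaban1983to89.PBond (F.P (Summit.QuantumFields.YangMills.Theorems.K0RecordFormatNames.recordK₀ F Mc k + n)) 0) - Hr (⟨b.src, ν⟩ : Literature.MathematicalPhysics.QuantumFieldTheory.Balaban1983to89.PBond (F.P (Summit.QuantumFields.YangMills.Theorems.K0RecordFormatNames.recordK₀ F Mc k + n)) 0)) - (Hr (⟨b.src.unshift ν, b.dir⟩ : Literature.MathematicalPhysics.QuantumFieldTheory.Balaban1983to89.PBond (F.P (Summit.QuantumFields.YangMills.Theorems.K0RecordFormatNames.recordK₀ F Mc k + n)) 0) + Hr (⟨(b.src.unshift ν).shift b.dir, ν⟩ : Literature.MathematicalPhysics.QuantumFieldTheory.Balaban1983to89.PBond (F.P (Summit.QuantumFields.YangMills.Theorems.K0RecordFormatNames.recordK₀ F Mc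 k + n)) 0) - Hr (⟨(b.src.unshift ν).shift ν, b.dir⟩ : Literature.MathematicalPhysics.QuantumFieldTheory.Balaban1983to89.PBond (F.P (Summit.QuantumFields.YangMills.Theorems.K0RecordFormatNames.recordK₀ F Mc k + n)) 0) - Hr (⟨b.src.unshift ν, ν⟩ : Literature.MathematicalPhysics.QuantumFieldTheory.Balaban1983to89.PBond (F.P (Summit.QuantumFields.YangMills.Theorems.K0RecordFormatNames.recordK₀ F Mc k + n)) 0)))‖ ≤ C₉' * (F.P (Summit.QuantumFields.YangMills.Theorems.K0RecordFormatNames.recordK₀ F Mc k + n)).eta (k + 1) ^ 3 * Real.exp (-(δ₉ * (Literature.MathematicalPhysics.QuantumFieldTheory.Balaban1983to89.Site.tdist (Summit.QuantumFields.YangMills.Theorems.K0RecordFormatNames.coarsenTo (k + 1) b.src) y : ℝ)))) → ∀ ε₂₉ : ℝ, 0 < ε₂₉ → ∀ (α₀ α₁ : ℝ), 0 < α₀ → 0 < α₁ → ∀ (k n : ℕ), letI θ := Summit.QuantumFields.YangMills.Theorems.K0RecordFormatNames.thetaFill F a₀ ε₂₉; letI := θ.instVβ₁; letI := θ.instVβ₂;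 letI := θ.instιβ; ∀ᶠ B in nhds (0 : Summit.QuantumFields.YangMills.Theorems.K0RecordFormatNames.recordW F a₀ ε₂₉ k (Summit.QuantumFields.YangMills.Theorems.K0RecordFormatNames.recordK₀ F Mc k + n)), Summit.QuantumFields.YangMills.Theorems.K0RecordFormatNames.CutsInUc F Mc k α₀ α₁ a₀ ε₂₉ n B

/-! ## §3  ★★★ Strong induction in the Uc currency; the germ edition as a corollary -/

/-- **All FE residues (Uc) from the step** — strong induction on `k`. [cite: Balaban1987RG1, p.268 L27–31, Thm 3 p.264] -/
theorem feResidueUcBoxAt_all_of_step {F : T4Family} {Mc : ℕ} {a₀ ε₂₉ γ₀ α₀ α₁ E₂ κ : ℝ}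
    (hstep : ∀ k : ℕ, (∀ j : ℕ, j < k → FEResidueUcBoxAt F Mc a₀ ε₂₉ γ₀ α₀ α₁ E₂ κ j) → FEResidueUcBoxAt F Mc a₀ ε₂₉ γ₀ α₀ α₁ E₂ κ k) :
    ∀ k : ℕ, FEResidueUcBoxAt F Mc a₀ ε₂₉ γ₀ α₀ α₁ E₂ κ k :=
  fun k => Nat.strong_induction_on k fun n ih => hstep n ih

/-- **Uc ⟹ germ, FE format at one level**, given the near-`0` domain condition at that level's radii. [cite: Balaban1987RG1, (1.7) p.261 (bookkeeping)] -/
theorem feResidueBoxAt_of_uc {F : T4Family} {Mc : ℕ} {a₀ ε₂₉ γ₀ α₀ α₁ E₂ κ : ℝ} {k : ℕ}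
    (h : FEResidueUcBoxAt F Mc a₀ ε₂₉ γ₀ α₀ α₁ E₂ κ k)
    (hnear : ∀ n, letI θ := thetaFill F a₀ ε₂₉; letI := θ.instVβ₁; letI := θ.instVβ₂; letI := θ.instιβ
      ∀ᶠ B in 𝓝 (0 : recordW F a₀ ε₂₉ k (recordK₀ F Mc k + n)), CutsInUc F Mc k α₀ α₁ a₀ ε₂₉ n B) :
    FEResidueBoxAt F Mc a₀ ε₂₉ γ₀ α₀ α₁ E₂ κ k := by
  intro v hv
  obtain ⟨Ψ, Ew, hR⟩ := h v hv
  exact ⟨Ψ, Ew, residueAtW_of_onUc hR hnear⟩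

/-- **Uc ⟹ germ, LZ format at one level.** [cite: Balaban1987RG1, (1.7) p.261 (bookkeeping)] -/
theorem lzResidueAt_of_uc {F : T4Family} {Mc : ℕ} {a₀ ε₂₉ α₀ α₁ E₁ κ : ℝ} {k : ℕ}
    (h : LZResidueUcAt F Mc a₀ ε₂₉ α₀ α₁ E₁ κ k)
    (hnear : ∀ n, letI θ := thetaFill F a₀ ε₂₉; letI := θ.instVβ₁; letI := θ.instVβ₂; letI := θ.instιβ
      ∀ᶠ B in 𝓝 (0 : recordW F a₀ ε₂₉ k (recordK₀ F Mc k + n)), CutsInUc F Mc k α₀ α₁ a₀ ε₂₉ n B) :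
    LZResidueAt F Mc a₀ ε₂₉ α₀ α₁ E₁ κ k := by
  obtain ⟨Ψ, Ew, hR⟩ := h
  exact ⟨Ψ, Ew, residueAtW_of_onUc hR hnear⟩

/-- ★★★ **`PortRecordFEHalfBox` (THE REGISTERED STUB's TYPE) FROM THE Uc LETTERS — GERM AS COROLLARY**: the LZ half (Uc) feeds the Uc step its constants at FE's `ε₂₉`; strong induction gives the FE
residues (Uc) at every level with k-uniform constants; the regularity letter turns each into the germ residue ✓`PortRecordFEHalfBox` asks for.  CONDITIONAL bookkeeping; the three letters OPEN.
[cite: Balaban1987RG1, Thm 3 p.264, p.268 L27–31, (1.7) p.261, (2.12)–(2.14) p.268] -/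
theorem portRecordFEHalfBox_of_uc (hLZ : ∀ F, PortRecordLZHalfUc F) (hS : ∀ F, FEStepUc F) (hN : ∀ F, CutsInUcNear F) :
    ∀ F, Summit.QuantumFields.YangMills.Theorems.BalabanUVNodesPortS1.PortRecordFEHalfBox F := by
  intro F
  obtain ⟨M₁, H₁⟩ := hLZ F
  obtain ⟨M₂, H₂⟩ := hS F
  obtain ⟨M₃, H₃⟩ := hN F
  refine ⟨max (max M₁ M₂) M₃, fun Mc hMc j c c₀ c₁ B₃ B₃' a₀ a₁ hG h₁ h₂ h₃ h₄ h₅ h₆ h₇ hT8 hT9 hTE hP9 hP9L => ?_⟩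
  have hM₁ : M₁ ≤ Mc := (le_max_left _ _).trans ((le_max_left _ _).trans hMc)
  have hM₂ : M₂ ≤ Mc := (le_max_right _ _).trans ((le_max_left _ _).trans hMc)
  have hM₃ : M₃ ≤ Mc := (le_max_right _ _).trans hMc
  obtain ⟨ε₂₉, hε, HS⟩ := H₂ Mc hM₂ j c c₀ c₁ B₃ B₃' a₀ a₁ hG h₁ h₂ h₃ h₄ h₅ h₆ h₇ hT8 hT9 hTE hP9 hP9L
  obtain ⟨E₁, κ₁, β₀, β₁, hE₁, hκ₁, hβ₀, hβ₁, HLZ⟩ := H₁ Mc hM₁ j c c₀ c₁ B₃ B₃' a₀ a₁ hG h₁ h₂ h₃ h₄ h₅ h₆ h₇ hT8 hT9 hTE hP9 hP9L ε₂₉ hε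
  have HN := H₃ Mc hM₃ j c c₀ c₁ B₃ B₃' a₀ a₁ hG h₁ h₂ h₃ h₄ h₅ h₆ h₇ hT8 hT9 hTE hP9 hP9L ε₂₉ hε
  obtain ⟨γ₀, E₂, κ, α₀, α₁, hγ, hE₂, hκ, hα₀, hα₁, Hstep⟩ := HS E₁ κ₁ β₀ β₁ hE₁ hκ₁ hβ₀ hβ₁ HLZ
  refine ⟨γ₀, ε₂₉, E₂, κ, α₀, α₁, hγ, hε, hE₂, hκ, hα₀, hα₁, fun k v hv => ?_⟩
  exact feResidueBoxAt_of_uc (feResidueUcBoxAt_all_of_step Hstep k) (fun n => HN α₀ α₁ hα₀ hα₁ k n) v hv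

-- standard axioms only
#print axioms portRecordFEHalfBox_of_uc

end Summit.QuantumFields.YangMills.Theorems.BalabanUVNodesPortS1

end
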